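import Mathlib

/-!
# BridgeCore — the kernel-checked linear-algebra core of the Albanese-transfer bridge (Tier 4, T4-A)

Seat p4 of the blind cell pub-hodge-repro2 (README §6, T4-A). Nothing in this file is about
varieties: it isolates the linear algebra that the prose bridge argument uses (route/TIER4.md T4-A;
route/TIER3.md §6 item 16 (α)–(ζ) and §4.4′ row T4), with every geometric input stated as a named
hypothesis of a structure, so that the referees can see exactly which steps are kernel-checked and
which are geometric inputs.

Dictionary (prose object ↦ this file):
* `R`            ↦ the commutative ℚ-algebra `𝐅 ⊗ 𝐅 ⊗ 𝐅 ⊗ 𝐅` acting on the (1,1,1,1)-Künneth piece of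
                   `H⁴(B, ℚ)`, `B = ∏ᵢ A_{Tᵢ}`, through the four `𝐅`-actions (algebraic correspondences
                   of `B`);
* `V`, `V'`      ↦ the (1,1,1,1)-Künneth pieces of `H⁴(B, ℚ)` and of `H^{20}(B, ℚ) ≅ H₄(B, ℚ)`;
* `alg`, `alg'`  ↦ the ℚ-spans of the algebraic classes inside them — `R`-submodules because pull-back
                   and push-forward along the endomorphisms `(f₁, …, f₄)` of `B` preserve algebraic
                   classes, and the Künneth projector is a polynomial in such correspondences;
* `weil`         ↦ the split Weil line `W_𝐅(B) = ⋀⁴_𝐅 H¹(B, ℚ)`: a simple `R`-module (a 1-dimensional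
                   `𝐅`-vector space on which `R` acts through the multiplication map `R → 𝐅`,
                   `isSimpleModule_of_surjective_of_finrank_eq_one`);
* `e`            ↦ the `𝐅`-isotypic idempotent of `R` that cuts out `weil`;
* `pair`         ↦ the Poincaré/Kronecker pairing `H^{20}(B,ℚ) × H⁴(B,ℚ) → ℚ`, balanced for the
                   correspondence actions: `⟨f_* z, w⟩ = ⟨z, f^* w⟩`;
* `transfer`     ↦ the inverse Lefschetz operator `L^{-8} : H^{20}(B,ℚ) → H⁴(B,ℚ)`, algebraic on abelian
                   varieties (Lieberman 1968, as quoted in TIER3 §6 item 16 (ζ));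
* `z`            ↦ the Gysin image `f_*[S]` of the fundamental class of the compact Picard modular
                   surface `S` under `f = (f₁, …, f₄) : S → B`;
* `∃ w ∈ weil, pair z w ≠ 0` ↦ the non-vanishing of the quadruple period (item 16 (α)) — the ONLY
                   place where the analytic input enters.

Contents.
1. `le_of_inf_ne_bot` (line-hit lemma): a simple submodule met non-trivially is contained.
2. `isSimpleModule_of_surjective_of_finrank_eq_one`: an `𝐅`-line is a simple `R`-module.
3. `BridgeData` and `BridgeData.weil_le_alg_of_pair_ne_zero`: THE BRIDGE — non-vanishing of one period
   against the Weil line forces the whole Weil line to be algebraic.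
4. `exists_sum_ne_zero_iff` (Galois collapse, item 16 (α)): the projection of a rational class to the
   Weil line is non-zero iff one of its `[𝐅:ℚ]` complex eigen-periods is non-zero (Dedekind
   independence of the embeddings).
5. Hodge-type bookkeeping (`Bigrading`, `Integral`): a period of `2m` one-forms against a functional
   supported in bidegree `(m, m)` vanishes unless exactly `m` of them are holomorphic — balance is
   necessary; balance makes the product of type `(2,2)`; a conjugate pair gives a `(1,1)`-class
   (item 16 (β)).
-/

namespace Summit.Ventures.HodgeRepro2.BridgeCore

/-! ## 1. The line-hit lemma -/

section LineHit

variable {R : Type*} [CommRing R] {V : Type*} [AddCommGroup V] [Module R V]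

/-- **Line-hit lemma.** If `W ≤ V` is a simple `R`-submodule and `A ≤ V` is any `R`-submodule with
`A ⊓ W ≠ ⊥`, then `W ≤ A`. (Applied with `A` = algebraic classes, `W` = the split Weil line: one
non-zero algebraic class on the Weil line makes the whole line algebraic.) -/
theorem le_of_inf_ne_bot (A W : Submodule R V) [IsSimpleModule R W] (h : A ⊓ W ≠ ⊥) : W ≤ A := by
  classical
  set N : Submodule R W := (A ⊓ W).comap W.subtype with hN
  rcases eq_bot_or_eq_top N with hb | ht
  · exfalso
    apply h
    rw [eq_bot_iff]
    intro x hx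
    have hxW : x ∈ W := hx.2
    have hmem : (⟨x, hxW⟩ : W) ∈ N := by
      rw [hN, Submodule.mem_comap]
      exact hx
    rw [hb, Submodule.mem_bot] at hmem
    have hx0 : x = 0 := by simpa using congrArg Subtype.val hmem
    rw [hx0]
    exact Submodule.zero_mem _
  · intro w hw
    have hmem : (⟨w, hw⟩ : W) ∈ N := by rw [ht]; exact Submodule.mem_top
    rw [hN, Submodule.mem_comap] at hmem
    exact hmem.1

end LineHit

/-! ## 2. A field line is a simple module -/

section FieldLine

variable {R : Type*} [CommRing R] {F : Type*} [Field F] [Algebra R F]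
  {W : Type*} [AddCommGroup W] [Module R W] [Module F W] [IsScalarTower R F W]

/-- Every `R`-submodule of `W` is the restriction of scalars of an `F`-submodule when the structure map
`R → F` is surjective (the `R`-action on `W` factors through `F`). -/
theorem exists_restrictScalars_eq (hsurj : Function.Surjective (algebraMap R F))
    (N : Submodule R W) : ∃ N' : Submodule F W, N'.restrictScalars R = N := by
  refine ⟨{ carrier := N
            add_mem' := fun ha hb => N.add_mem ha hb
            zero_mem' := N.zero_mem
            smul_mem' := ?_ }, ?_⟩
  · intro c x hx
    obtain ⟨r, hr⟩ := hsurj c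
    have hcx : c • x = r • x := by rw [← hr, algebraMap_smul]
    show c • x ∈ N
    rw [hcx]
    exact N.smul_mem r hx
  · ext x
    exact Iff.rfl

/-- **A field line is simple.** A 1-dimensional `F`-vector space `W` on which the commutative ring `R`
acts through a surjective ring map `R → F` is a simple `R`-module. (The split Weil line
`W_𝐅(B) = ⋀⁴_𝐅 H¹(B,ℚ)` is a 1-dimensional `𝐅`-space and `𝐅 ⊗ 𝐅 ⊗ 𝐅 ⊗ 𝐅 → 𝐅` is surjective.) -/
theorem isSimpleModule_of_surjective_of_finrank_eq_one
    (hsurj : Function.Surjective (algebraMap R F)) (h1 : Module.finrank F W = 1) :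
    IsSimpleModule R W := by
  haveI : IsSimpleModule F W := isSimpleModule_iff_finrank_eq_one.2 h1
  haveI : Nontrivial W := Module.nontrivial_of_finrank_pos (R := F) (by omega)
  haveI : Nontrivial (Submodule R W) := (Submodule.nontrivial_iff R).2 inferInstance
  haveI hso : IsSimpleOrder (Submodule R W) := by
    refine ⟨fun N => ?_⟩
    obtain ⟨N', hN'⟩ := exists_restrictScalars_eq hsurj N
    rcases eq_bot_or_eq_top N' with h | h
    · left
      rw [← hN', h, Submodule.restrictScalars_bot]
    · right
      rw [← hN', h, Submodule.restrictScalars_top]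
  exact ⟨⟩

end FieldLine

/-! ## 3. The bridge -/

section Bridge

variable (R : Type*) [CommRing R] (V : Type*) [AddCommGroup V] [Module R V]
  (V' : Type*) [AddCommGroup V'] [Module R V']

/-- **The abstract data of the Albanese-transfer bridge** (TIER3 §6 item 16, §4.4′ row T4). Every
field is a geometric input of the prose argument, stated as a hypothesis:
* `alg` / `alg'`: the algebraic classes in the (1,1,1,1)-Künneth pieces of `H⁴(B,ℚ)` / `H^{20}(B,ℚ)`,
  `R`-submodules (correspondence actions preserve algebraic classes);
* `weil`: the split Weil line, with the isotypic idempotent `e ∈ R`: `e • V ⊆ weil` and `e` is the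
  identity on `weil`;
* `pair`: the Poincaré pairing, vanishing on `0` and balanced for the `R`-action;
* `transfer`: the inverse Lefschetz operator `L^{-8}`, algebraic (`alg' ↦ alg`), commuting with `e`
  and injective on `e • V'`. -/
structure BridgeData where
  /-- algebraic classes on the cohomology side `H⁴(B,ℚ)` (an `R`-submodule) -/
  alg : Submodule R V
  /-- algebraic classes on the homology side `H^{20}(B,ℚ) ≅ H₄(B,ℚ)` (an `R`-submodule) -/
  alg' : Submodule R V'
  /-- the split Weil line `W_𝐅(B)` -/
  weil : Submodule R V
  /-- the `𝐅`-isotypic idempotent cutting out `weil` -/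
  e : R
  /-- `e` maps everything into the Weil line -/
  e_smul_mem : ∀ v : V, e • v ∈ weil
  /-- `e` is the identity on the Weil line -/
  e_smul_eq : ∀ w ∈ weil, e • w = w
  /-- the Poincaré / Kronecker pairing `H^{20} × H⁴ → ℚ` -/
  pair : V' → V → ℚ
  /-- the pairing vanishes on `0` -/
  pair_zero_left : ∀ w, pair 0 w = 0
  /-- balance: `⟨r • z, w⟩ = ⟨z, r • w⟩` (push-forward is adjoint to pull-back) -/
  pair_balanced : ∀ (r : R) (z : V') (w : V), pair (r • z) w = pair z (r • w)
  /-- the transfer `L^{-8} : H^{20}(B,ℚ) → H⁴(B,ℚ)` -/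
  transfer : V' → V
  /-- the transfer is algebraic (Lieberman 1968 for abelian varieties) -/
  transfer_mem : ∀ z ∈ alg', transfer z ∈ alg
  /-- the transfer commutes with the isotypic idempotent -/
  transfer_e : ∀ z : V', transfer (e • z) = e • transfer z
  /-- the transfer is injective on the Weil part of `V'` -/
  transfer_inj : ∀ z : V', transfer (e • z) = 0 → e • z = 0

variable {R V V'}

namespace BridgeData

variable (D : BridgeData R V V')

/-- The isotypic element is idempotent on `V`. -/
theorem e_smul_e_smul (v : V) : D.e • (D.e • v) = D.e • v :=
  D.e_smul_eq _ (D.e_smul_mem v)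

/-- The Weil line is exactly the image of `e`. -/
theorem mem_weil_iff (v : V) : v ∈ D.weil ↔ D.e • v = v :=
  ⟨D.e_smul_eq v, fun h => h ▸ D.e_smul_mem v⟩

/-- **Cohomological form of the bridge.** An algebraic class in `H⁴(B,ℚ)` with non-zero Weil
component makes the whole Weil line algebraic. -/
theorem weil_le_alg_of_e_smul_ne_zero [IsSimpleModule R D.weil] {v : V} (hv : v ∈ D.alg)
    (hne : D.e • v ≠ 0) : D.weil ≤ D.alg := by
  apply le_of_inf_ne_bot
  intro hbot
  apply hne
  have hmem : D.e • v ∈ D.alg ⊓ D.weil := ⟨D.alg.smul_mem _ hv, D.e_smul_mem v⟩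
  rw [hbot] at hmem
  exact (Submodule.mem_bot R).1 hmem

/-- **THE BRIDGE (homological form).** Let `z ∈ alg'` be an algebraic class on the homology side (the
Gysin image `f_*[S]` of the fundamental class of the Picard modular surface). If its pairing with
SOME element of the Weil line is non-zero — the quadruple period — then the WHOLE split Weil line is
algebraic. This is exactly where non-vanishing enters, and it is the only place. -/
theorem weil_le_alg_of_pair_ne_zero [IsSimpleModule R D.weil] {z : V'} (hz : z ∈ D.alg')
    (hnv : ∃ w ∈ D.weil, D.pair z w ≠ 0) : D.weil ≤ D.alg := by
  obtain ⟨w, hw, hne⟩ := hnv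
  have h1 : D.pair (D.e • z) w ≠ 0 := by
    rwa [D.pair_balanced, D.e_smul_eq w hw]
  have h2 : D.e • z ≠ 0 := fun h => h1 (by rw [h, D.pair_zero_left])
  have h3 : D.e • D.transfer z ≠ 0 := by
    rw [← D.transfer_e]
    exact fun h => h2 (D.transfer_inj z h)
  exact D.weil_le_alg_of_e_smul_ne_zero (D.transfer_mem z hz) h3

/-- The non-vanishing hypothesis of the bridge is equivalent to the non-vanishing of the Weil
component of `z`, paired against the Weil line: `pair z w = pair (e • z) w` for `w` on the line. -/
theorem pair_e_smul (z : V') {w : V} (hw : w ∈ D.weil) : D.pair (D.e • z) w = D.pair z w := by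
  rw [D.pair_balanced, D.e_smul_eq w hw]

/-- Contrapositive bookkeeping: if the Weil component of `z` is zero, every period of `z` against the
Weil line vanishes. -/
theorem pair_eq_zero_of_e_smul_eq_zero {z : V'} (hz : D.e • z = 0) {w : V} (hw : w ∈ D.weil) :
    D.pair z w = 0 := by
  rw [← D.pair_e_smul z hw, hz, D.pair_zero_left]

end BridgeData

end Bridge

/-! ## 4. Galois collapse of the Weil-line period (TIER3 §6 item 16 (α)) -/

section GaloisCollapse

variable {F : Type*} [Field F] {L : Type*} [CommRing L] [IsDomain L] {ι : Type*} [Fintype ι]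

omit [Fintype ι] in
/-- Distinct ring homomorphisms `F →+* L` are linearly independent as functions (Dedekind's lemma,
transported from `linearIndependent_monoidHom`). -/
theorem linearIndependent_ringHom (τ : ι → (F →+* L)) (hτ : Function.Injective τ) :
    LinearIndependent L (fun i : ι => ((τ i : F →* L) : F → L)) := by
  have hinj : Function.Injective (fun i : ι => (τ i : F →* L)) := by
    intro i i' h
    apply hτ
    ext x
    have := DFunLike.congr_fun h x
    simpa using this
  exact (linearIndependent_monoidHom F L).comp (fun i : ι => (τ i : F →* L)) hinj

/-- **Galois collapse.** Over `ℂ` the Weil line splits into its `[𝐅:ℚ]` eigenlines; a rational class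
`λ • w₀` pairs with `f_*[S]` as `∑ⱼ τⱼ(λ) aⱼ` where `aⱼ` is the `j`-th complex eigen-period. The
projection to the Weil line is non-zero for SOME rational class iff SOME eigen-period `aⱼ` is non-zero
(the embeddings `τⱼ` are linearly independent). -/
theorem exists_sum_ne_zero_iff (τ : ι → (F →+* L)) (hτ : Function.Injective τ) (a : ι → L) :
    (∃ lam : F, ∑ j, τ j lam * a j ≠ 0) ↔ ∃ j, a j ≠ 0 := by
  constructor
  · rintro ⟨lam, h⟩
    by_contra hall
    have hall' : ∀ j, a j = 0 := fun j => by_contra fun hne => hall ⟨j, hne⟩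
    apply h
    simp [hall']
  · rintro ⟨j, hj⟩
    by_contra hall
    have hall' : ∀ lam : F, ∑ j, τ j lam * a j = 0 := fun lam =>
      by_contra fun hne => hall ⟨lam, hne⟩
    have hli := linearIndependent_ringHom τ hτ
    rw [Fintype.linearIndependent_iff] at hli
    apply hj
    apply hli a _ j
    funext lam
    have h1 : (∑ i, a i • ((τ i : F →* L) : F → L)) lam = ∑ i, a i * τ i lam := by
      simp [Finset.sum_apply]
    rw [h1, Pi.zero_apply, ← hall' lam]
    exact Finset.sum_congr rfl (fun i _ => mul_comm _ _)

end GaloisCollapse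

/-! ## 5. Hodge-type bookkeeping of the quadruple period -/

section HodgeType

variable {H : Type*} [CommRing H]

/-- A bigrading predicate on a commutative ring (the cohomology ring of the surface `S`, or its
complexification): `IsType p q x` says `x` is of pure bidegree `(p, q)`. Only multiplicativity and
the type of `1` are used. -/
structure Bigrading (H : Type*) [CommRing H] where
  /-- `x` is of pure Hodge type `(p, q)` -/
  IsType : ℕ → ℕ → H → Prop
  /-- `1` has type `(0, 0)` -/
  isType_one : IsType 0 0 1
  /-- types add under multiplication (cup product) -/
  isType_mul : ∀ {p q p' q' : ℕ} {x y : H}, IsType p q x → IsType p' q' y →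
    IsType (p + p') (q + q') (x * y)

/-- An "integral" supported in bidegree `(m, m')`: a function on `H` that kills every pure type other
than `(m, m')` (for a compact complex surface, `∫_S` on `H⁴(S, ℂ)` is supported in type `(2, 2)`). -/
structure Integral (B : Bigrading H) (m m' : ℕ) where
  /-- the functional -/
  integral : H → ℂ
  /-- it vanishes on pure types other than `(m, m')` -/
  vanish : ∀ (p q : ℕ) (x : H), B.IsType p q x → (p ≠ m ∨ q ≠ m') → integral x = 0

namespace Bigrading

variable (B : Bigrading H)

/-- A product of pure-type elements is pure of the summed type. -/
theorem isType_prod {n : ℕ} (η : Fin n → H) (p q : Fin n → ℕ)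
    (h : ∀ i, B.IsType (p i) (q i) (η i)) :
    B.IsType (∑ i, p i) (∑ i, q i) (∏ i, η i) := by
  induction n with
  | zero => simpa using B.isType_one
  | succ n ih =>
    rw [Fin.prod_univ_succ, Fin.sum_univ_succ, Fin.sum_univ_succ]
    exact B.isType_mul (h 0) (ih (fun i => η i.succ) (fun i => p i.succ) (fun i => q i.succ)
      (fun i => h i.succ))

/-- The bidegree of a one-form of "holomorphic bit" `t`: `(1,0)` if `t = true`, `(0,1)` if `t = false`. -/
def oneFormType (t : Bool) : ℕ × ℕ := if t then (1, 0) else (0, 1)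

/-- Sum of the holomorphic degrees of a family of one-forms = number of holomorphic ones. -/
theorem sum_fst_oneFormType {n : ℕ} (t : Fin n → Bool) :
    ∑ i, (oneFormType (t i)).1 = (Finset.univ.filter fun i => t i = true).card := by
  have : ∀ i, (oneFormType (t i)).1 = if t i = true then 1 else 0 := by
    intro i
    cases t i <;> simp [oneFormType]
  simp only [this]
  rw [Finset.sum_boole]
  simp

/-- Sum of the antiholomorphic degrees of a family of one-forms = number of antiholomorphic ones. -/
theorem sum_snd_oneFormType {n : ℕ} (t : Fin n → Bool) :
    ∑ i, (oneFormType (t i)).2 = (Finset.univ.filter fun i => t i = false).card := by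
  have : ∀ i, (oneFormType (t i)).2 = if t i = false then 1 else 0 := by
    intro i
    cases t i <;> simp [oneFormType]
  simp only [this]
  rw [Finset.sum_boole]
  simp

/-- **Balance is necessary.** If `η₁, …, ηₙ` are one-forms of holomorphic bits `t₁, …, tₙ` and a
functional supported in bidegree `(m, m')` does not kill their product, then exactly `m` of them are
holomorphic and exactly `m'` antiholomorphic. For the quadruple period on the Picard modular surface
(`n = 4`, `(m, m') = (2, 2)`): the eigen-period at `σ` can be non-zero only if `σ` lies in exactly two
of the four CM types — Deligne's balance condition for the face (TIER3 §6 item 16 (α)). -/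
theorem card_eq_of_integral_ne_zero {m m' : ℕ} (I : Integral B m m') {n : ℕ}
    (η : Fin n → H) (t : Fin n → Bool)
    (h : ∀ i, B.IsType (oneFormType (t i)).1 (oneFormType (t i)).2 (η i))
    (hne : I.integral (∏ i, η i) ≠ 0) :
    (Finset.univ.filter fun i => t i = true).card = m ∧
      (Finset.univ.filter fun i => t i = false).card = m' := by
  have hprod := B.isType_prod η _ _ h
  rw [sum_fst_oneFormType, sum_snd_oneFormType] at hprod
  by_contra hcon
  apply hne
  apply I.vanish _ _ _ hprod
  tauto

/-- **Balance suffices for the type.** If exactly `m` of the one-forms are holomorphic and `m'`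
antiholomorphic, their product is of pure type `(m, m')` — for a balanced face, the product of the
four pulled-back eigenforms is a `(2,2)`-form on `S`, so its integral is not killed by type. -/
theorem isType_prod_of_card_eq {m m' : ℕ} {n : ℕ} (η : Fin n → H) (t : Fin n → Bool)
    (h : ∀ i, B.IsType (oneFormType (t i)).1 (oneFormType (t i)).2 (η i))
    (hm : (Finset.univ.filter fun i => t i = true).card = m)
    (hm' : (Finset.univ.filter fun i => t i = false).card = m') :
    B.IsType m m' (∏ i, η i) := by
  have hprod := B.isType_prod η _ _ h
  rwa [sum_fst_oneFormType, sum_snd_oneFormType, hm, hm'] at hprod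

/-- **A conjugate pair is a `(1,1)`-class** (item 16 (β)): one holomorphic and one antiholomorphic
one-form multiply to a class of type `(1, 1)`. -/
theorem isType_one_one_of_ne {x y : H} {s t : Bool} (hst : s ≠ t)
    (hx : B.IsType (oneFormType s).1 (oneFormType s).2 x)
    (hy : B.IsType (oneFormType t).1 (oneFormType t).2 y) :
    B.IsType 1 1 (x * y) := by
  have := B.isType_mul hx hy
  cases s <;> cases t <;> simp_all [oneFormType]

end Bigrading

end HodgeType

end Summit.Ventures.HodgeRepro2.BridgeCore
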